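import Summits.PneNP.PneNP.Theses.SymmetryBudget

/-!
# `NoHiddenOrder ↔ ¬ WindowBarrier` (route `PneNP/SymmetryBudget`, items stmt-PneNP-14781 / stmt-PneNP-2145)

The crux `NoHiddenOrder` ("no hidden order at scale `log m`": every `P` language with
`Bud(m,⌊log₂ m⌋)`-invariant graph slices has, for one polynomial and all large `m`, a
`Bud(m,⌊log₂ m⌋)`-symmetric threshold circuit of that size) is, literally, the classical dual of the
support item `WindowBarrier` (some such language is, for every polynomial, infinitely often
symmetric-hard): de Morgan plus `Filter.not_eventually`, the two inline `let` vocabularies being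
syntactically identical. Recorded here as an importable bridge so that a theorem settling either
item settles the other in one line; combined with `tameCompiles_proof`
(`Theorems/SymmetryBudgetTameCompiles.lean`) a refutation of `WindowBarrier` already yields
`HamCompiles`. No definitions, no Literature facts.
-/

set_option linter.dupNamespace false -- `Summit.PneNP.PneNP.…`: summit = sub-problem name (D-0017 single-conjunct layout)

namespace Summit.PneNP.PneNP.Theorems

open Summit.PneNP.PneNP.Theses.SymmetryBudget

/-- **`NoHiddenOrder` is the classical dual of `WindowBarrier`** (items stmt-PneNP-14781 and
stmt-PneNP-2145 of route `SymmetryBudget`): `NoHiddenOrder ↔ ¬ WindowBarrier` by de Morgan and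
`Filter.not_eventually` (`¬ ∀ᶠ ↔ ∃ᶠ ¬`). Hence `noHiddenOrder_iff_not_windowBarrier.1 h` refutes
`WindowBarrier` from a proof `h` of `NoHiddenOrder`, and `.2 h` proves `NoHiddenOrder` from a
refutation `h` of `WindowBarrier`. [folklore] -/
theorem noHiddenOrder_iff_not_windowBarrier : NoHiddenOrder ↔ ¬ WindowBarrier := by
  constructor
  · rintro hN ⟨L, hL, hinv, hhard⟩
    obtain ⟨p, hp⟩ := hN L hL hinv
    obtain ⟨m, hm, hm'⟩ := ((hhard p).and_eventually hp).exists
    exact hm hm'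
  · intro hW L hL hinv
    by_contra h
    exact hW ⟨L, hL, hinv, fun p => Filter.not_eventually.1 fun hp => h ⟨p, hp⟩⟩

end Summit.PneNP.PneNP.Theorems
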